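import Summits.ABC.IUTFork.Thm311Real
import Literature.IUT.LogVolume.AdicCompletionLogShell
import Literature.IUT.LogThetaLattice.HolomorphicLogShellsProofs
import HarnessLib

/-!
# [IUTchIII] Cor. 3.12, TEAM B row B-3 (analytic discharge, nonarchimedean): the log-link-iterate
# images lie in the REAL log-shells — `Rmk 1.2.2 (iii)` for the cell's instantiated shells

Record-only file (D-0012) of the abc-iut cell (Cor. 3.12 strategy TEAM B «estimate / log-Kummer» of
HUMAN RULING D-0067 (3), row B-3 of `HOME/plan/C312-TEAMS.md`, seat abc-iut-c312-12 = B2; sequel to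
`Cor312Ind3Real`, p411624, whose DH corollary leaves the ITERATE components' containments as the named
hypotheses `hUiterNon`/`hUiterArc`); TAKES NO SIDE. [IUTchIII] Rmk. 1.2.2 (iii) (kurims p. 37): "the
coric holomorphic log-shells … contain not only the images, via the Kummer isomorphisms …, of the
various `𝒪^▷`, but also the images, via the composite of the Kummer isomorphisms with the various
iterates … of the log-link …, of the portions of the various `𝒪^▷` … on which these iterates are
defined" — the upper semi-commutativity feeding (Ind3).

At the model level this is LANDED (`iterate_image_subset_logShell_ofUnitLog`, abc-iut-L6-t3/L6-d2, for
the standard model `PadicLogOnUnits.ofUnitLog p K` over any mixed-characteristic field). This file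
TRANSPORTS it to the CELL'S instantiated shells `Real.shell logv (.inr v) ⊆ K_v` (the binder-level
shells of `Thm311Real`, `I_v = (p_v^*)⁻¹·log_v(𝒪_v^×)`), for any family `logv : PadicLogs F` whose
`v`-component is given by the ANALYTIC formula (abc-iut-S1's `unitLog` in abc-iut-S7's rescaled
completion `K_v^{(1/n_v)}` — the same elements as `K_v`; the shape of abc-iut-L5-t5's
`exists_logFamily_integersSubsetLogShell` and of `Real.analyticLogv`, p411812):

* `pStar_eq_pow` — `p^* = p^{1 or 2}` for a prime: abc-iut-L6-t3's `pStar` is the standard model's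
  `pstar` exponent ([IUTchIII] Def. 1.1 (i) "`p_v^* = p_v` if `p_v` odd, `p_v²` if even");
* `Real.exists_unit_of_norm_rescaled_eq_one` — every norm-`1` element of the rescaled completion is (the
  image of) a unit of `𝒪_v` (`mem_integers_iff_norm_rescaled_le_one` both ways);
* `Real.shell_eq_image_logShell_of_formula` — **the instantiated shell IS the standard model's
  log-shell**: `Real.shell logv (.inr v) = of⁻¹(ℐ_{K_v^{(1/n_v)}})` under the analytic formula (both
  sides are `(p^*)⁻¹·log(𝒪^×)`, the units matched by the previous item);
* `Real.analyticIterImage` — the image in `K_v` of the portion of the units on which the `m'`-th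
  iterate of the log-link is defined (Rmk. 1.1.1 (i), `iterDomain` of the standard model, read back
  along the rescaling); `Real.analyticIterImage_subset_shell_of_formula` — **for every `m' ≥ 1` it lies
  in the instantiated shell**: the discharge of the `hUiterNon` hypothesis of
  `Column.ind3_of_componentwise_logShellsDH` (p411624) at the analytic logarithms; with
  `analyticLogv_apply` (p411812) the formula hypothesis is satisfied by the canonical family.

Sources read on the page: [IUTchIII] p. 28 (Rmk. 1.1.1 (i)), p. 36–37 (Rmk. 1.2.2 (i), (iii)), p. 156
(Thm. 3.11 (ii) (Ind3)). [claim: Mochizuki2012, status: disputed]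
Deliberately NOT here: the archimedean iterate witnesses (`VerticallyCoricLGPArch`, p411153 — the
`hUiterArc` side), the packet-level assembly (p411624), any judgement on Cor. 3.12.
-/

noncomputable section

open Set Metric
open scoped Pointwise

namespace Summit.ABC.IUTFork.Thm311

open Literature.IUT.LogVolume Literature.IUT.LogThetaLattice
open Literature.AnabelianGeometry.AbsoluteAnabelian
open Literature.NumberTheory.NumberFields
open NumberField IsDedekindDomain

/-- **[IUTchIII] Def. 1.1 (i) (kurims p. 24)** `p^* = p` for odd `p`, `p²` for `p = 2` — for a PRIME `p`,
abc-iut-L6-t3's `pStar p = if Even p then p² else p` equals the standard model's exponent form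
`p^{if p = 2 then 2 else 1}` (`Nat.Prime.even_iff`). [claim: Mochizuki2012, status: disputed] -/
theorem pStar_eq_pow {p : ℕ} (hp : p.Prime) :
    pStar p = p ^ (if p = 2 then 2 else 1) := by
  by_cases h : p = 2
  · subst h
    rw [if_pos rfl]
    decide
  · unfold pStar
    rw [if_neg (by rw [Nat.Prime.even_iff hp]; exact h), if_neg h, pow_one]

namespace Real

variable {F : Type} [Field F] [NumberField F] (p : ℕ) [hp : Fact p.Prime]
  (v : HeightOneSpectrum (𝓞 F)) (hv : ((p : ℕ) : 𝓞 F) ∈ v.asIdeal)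

omit hp in
/-- Every norm-`1` element of the rescaled completion `K_v^{(1/n_v)}` is the image of a unit of `𝒪_v`
(`‖z‖ = 1` gives `z, z⁻¹ ∈ 𝒪_v` by `mem_integers_iff_norm_rescaled_le_one`; the converse is
`norm_of_coe_unit_adicCompletionIntegers`). [cite: NeukirchANT1999, Ch. II Prop. (3.3)] -/
theorem exists_unit_of_norm_rescaled_eq_one {z : RescaledCompletion F p v hv} (hz : ‖z‖ = 1) :
    ∃ x : (↥(integers v))ˣ,
      RescaledCompletion.of F p v hv (((x : ↥(integers v)) : Carrier (.inr v : Place F))) = z := by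
  have hz0 : z ≠ 0 := by
    intro h
    rw [h, norm_zero] at hz
    norm_num at hz
  have hmem : z ∈ (v.adicCompletionIntegers F :
      ValuationSubring (RescaledCompletion F p v hv)) :=
    (mem_integers_iff_norm_rescaled_le_one F p v hv z).mpr (le_of_eq hz)
  have hmemi : z⁻¹ ∈ (v.adicCompletionIntegers F :
      ValuationSubring (RescaledCompletion F p v hv)) :=
    (mem_integers_iff_norm_rescaled_le_one F p v hv z⁻¹).mpr (by rw [norm_inv, hz]; norm_num)
  refine ⟨⟨⟨z, hmem⟩, ⟨z⁻¹, hmemi⟩, ?_, ?_⟩, rfl⟩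
  · exact Subtype.ext (mul_inv_cancel₀ hz0)
  · exact Subtype.ext (inv_mul_cancel₀ hz0)

/-- **The instantiated shell IS the standard model's log-shell** ([IUTchIII] Rmk. 1.2.2 (i): both sides
are `(p^*)⁻¹·log(𝒪_v^×)`): for a family `logv` whose `v`-component is the analytic formula —
`log_v = of⁻¹ ∘ log_p ∘ of` with `log_p` abc-iut-S1's `unitLog` in the rescaled completion — the shell
`Real.shell logv (.inr v)` is the preimage (= `of.symm`-image) of the standard model's
`logShell (ofUnitLog p K_v^{(1/n_v)})`. [claim: Mochizuki2012, status: disputed] -/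
theorem shell_eq_image_logShell_of_formula (logv : PadicLogs F) (hres : residueChar F v = p)
    (hformula : ∀ u : (↥(integers v))ˣ,
      logv v (Additive.ofMul u) = (RescaledCompletion.of F p v hv).symm
        (unitLog (RescaledCompletion.of F p v hv
          (((u : ↥(integers v)) : Carrier (.inr v : Place F)))))) :
    shell logv (.inr v) = (RescaledCompletion.of F p v hv).symm ''
      logShell (PadicLogOnUnits.ofUnitLog p (RescaledCompletion F p v hv)) := by
  have hps : ((pStar (residueChar F v) : ℕ) : Carrier (.inr v : Place F)) =
      (RescaledCompletion.of F p v hv).symm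
        ((PadicLogOnUnits.ofUnitLog p (RescaledCompletion F p v hv)).pstar) := by
    rw [PadicLogOnUnits.ofUnitLog_pstar, map_natCast, hres, pStar_eq_pow hp.out]
    rfl
  rw [shell_inr]
  ext a
  constructor
  · rintro ⟨x, rfl⟩
    refine ⟨(PadicLogOnUnits.ofUnitLog p (RescaledCompletion F p v hv)).pstar⁻¹ •
      unitLog (RescaledCompletion.of F p v hv
        (((x : ↥(integers v)) : Carrier (.inr v : Place F)))), ?_, ?_⟩
    · refine Set.smul_mem_smul_set ?_
      refine ⟨RescaledCompletion.of F p v hv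
        (((x : ↥(integers v)) : Carrier (.inr v : Place F))), ?_, rfl⟩
      rw [mem_sphere_zero_iff_norm]
      exact norm_of_coe_unit_adicCompletionIntegers F p v hv x
    · simp only [smul_eq_mul, map_mul, map_inv₀]
      rw [hps, hformula x]
      rfl
  · rintro ⟨b, hb, rfl⟩
    obtain ⟨c, hc, rfl⟩ := hb
    obtain ⟨z, hz, rfl⟩ := hc
    rw [mem_sphere_zero_iff_norm] at hz
    obtain ⟨x, hx⟩ := exists_unit_of_norm_rescaled_eq_one p v hv hz
    refine ⟨x, ?_⟩
    simp only [smul_eq_mul, map_mul, map_inv₀, PadicLogOnUnits.ofUnitLog_log]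
    rw [hps, hformula x, hx]
    rfl

/-- **The image of the portion of the units on which the `m'`-th iterate of the log-link is defined**
([IUTchIII] Rmk. 1.1.1 (i): "iterates … are to be understood as being defined only on the [local]
units"), read back in `K_v` along the rescaling: the honest nonarchimedean ITERATE component of
`Column.ind3_of_componentwise_logShellsDH` (p411624). [claim: Mochizuki2012, status: disputed] -/
def analyticIterImage (m' : ℕ) : Set (Carrier (.inr v : Place F)) :=
  (RescaledCompletion.of F p v hv).symm ''
    ((PadicLogOnUnits.ofUnitLog p (RescaledCompletion F p v hv)).log^[m'] ''
      iterDomain (PadicLogOnUnits.ofUnitLog p (RescaledCompletion F p v hv)) m')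

/-- **[IUTchIII] Rmk. 1.2.2 (iii) (kurims p. 37) for the instantiated shells**: for every `m' ≥ 1` the
image of the `m'`-th iterate of the log-link on its domain of definition lies in the REAL log-shell
`Real.shell logv (.inr v)` — "although the diagram … fails to be commutative, the coric holomorphic
log-shells involved exhibit a sort of upper semi-commutativity". This discharges the `hUiterNon`
hypothesis of `Column.ind3_of_componentwise_logShellsDH` (p411624) at the analytic logarithms
(`Real.analyticLogv`, whose formula clause is `analyticLogv_apply`, p411812).
[claim: Mochizuki2012, status: disputed] -/
theorem analyticIterImage_subset_shell_of_formula (logv : PadicLogs F)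
    (hres : residueChar F v = p)
    (hformula : ∀ u : (↥(integers v))ˣ,
      logv v (Additive.ofMul u) = (RescaledCompletion.of F p v hv).symm
        (unitLog (RescaledCompletion.of F p v hv
          (((u : ↥(integers v)) : Carrier (.inr v : Place F))))))
    {m' : ℕ} (hm' : 1 ≤ m') :
    analyticIterImage p v hv m' ⊆ shell logv (.inr v) := by
  obtain ⟨n, rfl⟩ : ∃ n, m' = n + 1 := ⟨m' - 1, by omega⟩
  rw [shell_eq_image_logShell_of_formula p v hv logv hres hformula]
  exact Set.image_mono (iterate_image_subset_logShell_ofUnitLog p _ n)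

end Real

end Summit.ABC.IUTFork.Thm311

end
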